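import Literature.NumberTheory.LFunctions.DHFarZeroBounds
import Literature.NumberTheory.LFunctions.DHPositivitySum
import HarnessLib

/-!
# The core Deuring–Heilbronn inequality (Heath-Brown 1992, §6/§8: Lemma 6.1 + proof of Lemma 8.1)

Topic `Literature/NumberTheory/LFunctions`, sub-namespace `DHTest`. Everything here is PROVED
(no definitions).

We combine, for a primitive quadratic `χ` mod `q > 1`, a simple real zero `β₁` of `L(·, χ)`, a
zero `ρ₀ = β₀ + iγ₀ ≠ β₁` of `ζ(s)L(s, χ)` which is (penalised-)maximal, the test function
`g = testFn x₀ ε₂ ε₀ L α` with `σ₀ = 1 + 1/L`, `α = λ₀ + 1`, `λ₀ = (1 − β₀)L`, `λ₁ = (1 − β₁)L`: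

* the positivity device `0 ≤ K₁ + K₂ + K₃ + K₄` (`DHPositivitySum`),
* the four inequalities `re_charFordK_le` (at `σ₀`, `σ₀ + iγ₀`) and `re_fordK_le` (idem),
* the sign `Re H(W) ≥ 0` (`re_shapeLaplace_shape_nonneg`) of the near-zero terms other than `β₁`
  and `ρ₀` — this is where maximality enters: `Re W_ρ = (β₀ − Re ρ)L ≥ −ε₀`,

into `core_inequality` (Heath-Brown's (8.x): "`0 ≤ χ₀(ρ₀){F(−λ₀) − F(λ₁−λ₀) − F(0)} + Re{F(−λ₀+iμ₀) −
F(λ₁−λ₀+iμ₀)} − F(0) + f(0)(θ + ε)`"):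

`L·Re H(0) ≤ L(Re H(−λ₀) − Re H(λ₁−λ₀)) + L(Re H(−λ₀+iμ₀) − Re H(λ₁−λ₀+iμ₀)) + Ins
   + h(0)(E₁ + E₂ + E₃ + E₄) + (far zeros) + (left lines) + (trivial zeros)`,

`μ₀ = γ₀L`, where `Ins = L‖H(λ₁−λ₀+iμ₀)‖` if `β₁` is not within `δ` of `1 + iγ₀` and `0` otherwise.

## References

* D. R. Heath-Brown, Proc. London Math. Soc. (3) 64 (1992), §6 (6.4)–(6.5), Lemma 6.1, §8 Lemma 8.1.
  [cite: HeathBrown1992PLMS, Lemma 6.1 and Lemma 8.1]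
-/

noncomputable section

open Complex Real MeasureTheory Set Filter Topology Metric

namespace Literature.NumberTheory.LFunctions

namespace DHTest

open ExplicitPsiChar LaplaceShape

variable {q : ℕ} [NeZero q] {χ : DirichletCharacter ℂ q}

/-- A kept-term estimate: if `f ≥ 0` on `Tc` off `b₁`, `b₁ ≠ r`, then
`Σ_{z ∈ Tc} f z ≥ [b₁ ∈ Tc] f b₁ + [r ∈ Tc] f r`. [folklore] -/
theorem sum_ge_two_kept {Tc : Finset ℂ} {f : ℂ → ℝ} {b₁ r : ℂ} (hbr : b₁ ≠ r)
    (hf : ∀ z ∈ Tc, z ≠ b₁ → 0 ≤ f z) :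
    (if b₁ ∈ Tc then f b₁ else 0) + (if r ∈ Tc then f r else 0) ≤ ∑ z ∈ Tc, f z := by
  classical
  have hsub : Tc.filter (fun z ↦ z ∈ ({b₁, r} : Finset ℂ)) ⊆ Tc := Finset.filter_subset _ _
  have h1 : ∑ z ∈ Tc.filter (fun z ↦ z ∈ ({b₁, r} : Finset ℂ)), f z ≤ ∑ z ∈ Tc, f z := by
    refine Finset.sum_le_sum_of_subset_of_nonneg hsub fun z hz hnz ↦ hf z hz fun hzb ↦ hnz ?_
    rw [Finset.mem_filter]; exact ⟨hz, by simp [hzb]⟩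
  have h2 : ∑ z ∈ Tc.filter (fun z ↦ z ∈ ({b₁, r} : Finset ℂ)), f z =
      ∑ z ∈ ({b₁, r} : Finset ℂ), if z ∈ Tc then f z else 0 := by
    rw [Finset.filter_mem_eq_inter, ← Finset.sum_filter]
    congr 1
    ext z; simp [Finset.mem_inter, Finset.mem_filter, and_comm]
  rw [h2, Finset.sum_pair hbr] at h1
  exact h1

set_option maxHeartbeats 1000000 in
/-- **The core inequality.** Data: `χ` primitive quadratic mod `q > 1`; `0 < ε₂ ≤ x₀`, `0 ≤ ε₀`;
`L ≥ 4`; `0 < δ ≤ 1/4`; a simple real zero `β₁` with `1 − β₁ ≤ δ`; a zero `ρ₀ ≠ β₁` with `1 − Re ρ₀ ≤ δ`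
such that every other zero within `δ` of the line `Re = 1` at heights `≤ |Im ρ₀| + δ` has
`Re ρ ≤ Re ρ₀ + ε₀/L` (penalised maximality). With `σ₀ = 1 + 1/L`, `λ₀ = (1−β₀)L`,
`λ₁ = (1−β₁)L`, `α = λ₀ + 1`, `g = testFn x₀ ε₂ ε₀ L α`, `H = shapeLaplace (shape x₀ ε₂ ε₀) x₀`,
`μ₀ = γ₀ L`, `s₁ = σ₀`, `s₂ = σ₀ + iγ₀`:
`L Re H(0) ≤ L(Re H(−λ₀) − Re H(λ₁−λ₀)) + L(Re H(−λ₀+iμ₀) − Re H(λ₁−λ₀+iμ₀)) + Ins + h(0)ΣE + Σ(errors)`.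
[cite: HeathBrown1992PLMS, Lemma 6.1 and Lemma 8.1 (proof)] -/
theorem core_inequality (hprim : χ.IsPrimitive) (hquad : χ.IsQuadratic) (hq : 1 < q)
    {x₀ ε₂ ε₀ L δ : ℝ} (hε : 0 < ε₂) (hεx : ε₂ ≤ x₀) (hL : 4 ≤ L)
    (hδ : 0 < δ) (hδ' : δ ≤ 1 / 4)
    {β₁ : ℝ} (hβ₁0 : 0 < β₁) (hβ₁1 : β₁ < 1) (hLβ₁ : χ.LFunction β₁ = 0)
    (hm₁ : DirichletDisc.zeroOrder χ β₁ = 1) (hl₁δ : (1 - β₁) ≤ δ)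
    {ρ₀ : ℂ} (hρ₀ : riemannZeta ρ₀ = 0 ∨ χ.LFunction ρ₀ = 0) (hρ₀β₁ : ρ₀ ≠ β₁)
    (hρ₀re1 : ρ₀.re < 1) (hl₀δ : 1 - ρ₀.re ≤ δ)
    (hmax : ∀ ρ : ℂ, (riemannZeta ρ = 0 ∨ χ.LFunction ρ = 0) → ρ ≠ β₁ → 1 - δ ≤ ρ.re →
      |ρ.im| ≤ |ρ₀.im| + δ → ρ.re ≤ ρ₀.re + ε₀ / L) :
    let hχ : χ ≠ 1 := ne_one_of_isPrimitive hprim hq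
    let σ₀ : ℝ := 1 + 1 / L
    let lam₀ : ℝ := (1 - ρ₀.re) * L
    let lam₁ : ℝ := (1 - β₁) * L
    let α : ℝ := lam₀ + 1
    let γ₀ : ℝ := ρ₀.im
    let g := testFn x₀ ε₂ ε₀ L α
    let h := shape x₀ ε₂ ε₀
    let H := shapeLaplace h x₀
    let s₁ : ℂ := (σ₀ : ℂ) + (0 : ℝ) * I
    let s₂ : ℂ := (σ₀ : ℂ) + γ₀ * I
    let m := DirichletDisc.zeroOrder χ
    let Eχ : ℝ → ℝ := fun t ↦ 0.861 * (Real.log (2 / (σ₀ - 1)) + Real.log q + Real.log (|t| + 2) +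
        Real.log DirichletDisc.Zc) +
      (∑ ρ ∈ nearZeros hχ t δ, (m (ρ : ℂ) : ℝ)) * ((σ₀ - 1 + δ) / 0.74 ^ 2)
    let Eζ : ℝ → ℝ := fun t ↦ 0.861 * (Real.log (2 / (σ₀ - 1)) + Real.log (1 / (σ₀ - 1)) +
        Real.log (|t| + 3) + Real.log 21 + 2 * Real.log (|t| + 4)) +
      (∑ ρ ∈ nearZerosZeta t δ, (riemannZetaZeroOrder (ρ : ℂ) : ℝ)) * ((σ₀ - 1 + δ) / 0.74 ^ 2)
    let Farχ : ℝ → ℂ → ℝ := fun t s ↦ ‖∑' ρ : ↑((nearZeros hχ t δ : Set (charNontrivialZeros χ))ᶜ),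
        (m ((ρ : charNontrivialZeros χ) : ℂ) : ℂ) * fordLaplace₀ g (s - (ρ : charNontrivialZeros χ))‖
    let Farζ : ℝ → ℂ → ℝ := fun t s ↦ ‖∑' ρ : ↑((nearZerosZeta t δ : Set RHWave0.riemannZetaNontrivialZeros)ᶜ),
        (riemannZetaZeroOrder ((ρ : RHWave0.riemannZetaNontrivialZeros) : ℂ) : ℂ) *
          fordLaplace₀ g (s - (ρ : RHWave0.riemannZetaNontrivialZeros))‖
    let Tr : ℂ → ℝ := fun s ↦ ‖∑ τ ∈ charTrivialZeroFinset hχ, (m τ : ℂ) * fordLaplace₀ g (s - τ)‖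
    let Ins : ℝ := if ‖(β₁ : ℂ) - (1 + γ₀ * I)‖ ≤ δ then 0
      else L * ‖H (((lam₁ - lam₀ : ℝ) : ℂ) + (γ₀ * L : ℝ) * I)‖
    L * (H 0).re ≤
      L * ((H ((-lam₀ : ℝ) : ℂ)).re - (H ((lam₁ - lam₀ : ℝ) : ℂ)).re) +
      L * ((H (((-lam₀ : ℝ) : ℂ) + (γ₀ * L : ℝ) * I)).re -
        (H (((lam₁ - lam₀ : ℝ) : ℂ) + (γ₀ * L : ℝ) * I)).re) + Ins +
      h 0 * (Eχ 0 + Eχ γ₀ + Eζ 0 + Eζ γ₀) +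
      (Farχ 0 s₁ + Farχ γ₀ s₂ + Farζ 0 s₁ + Farζ γ₀ s₂) +
      (‖charEFRemainder χ g s₁‖ + ‖charEFRemainder χ g s₂‖ + ‖smoothedEFRemainder g s₁‖ +
        ‖smoothedEFRemainder g s₂‖) + (Tr s₁ + Tr s₂) := by
  intro hχ σ₀ lam₀ lam₁ α γ₀ g h H s₁ s₂ m Eχ Eζ Farχ Farζ Tr Ins
  have hL0 : 0 < L := by linarith
  have hx₀ : 0 ≤ x₀ := hε.le.trans hεx
  have hσ₀ : 1 < σ₀ := by simp only [σ₀]; have := one_div_pos.2 hL0; linarith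
  have hσ₀' : σ₀ ≤ 5 / 4 := by
    simp only [σ₀]; have : 1 / L ≤ 1 / 4 := one_div_le_one_div_of_le (by norm_num) hL; linarith
  have hσ₀1 : σ₀ - 1 = 1 / L := by simp only [σ₀]; ring
  have hlam₀ : 0 ≤ lam₀ := by simp only [lam₀]; nlinarith
  have hlam₁ : 0 ≤ lam₁ := by simp only [lam₁]; nlinarith
  have hα : 0 ≤ α := by simp only [α]; linarith
  set β₀ := ρ₀.re with hβ₀
  have hρ₀eq : ρ₀ = (β₀ : ℂ) + γ₀ * I := by simp [hβ₀, γ₀, Complex.re_add_im]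
  have hLc : (L : ℂ) ≠ 0 := by exact_mod_cast hL0.ne'
  -- (1) the four inequalities
  have I2 := re_charFordK_le hprim hq (ε₀ := ε₀) (α := α) hε hεx hL0 (σ₀ := σ₀) (t := 0) (δ := δ) hσ₀ hσ₀' hδ'
  have I4 := re_charFordK_le hprim hq (ε₀ := ε₀) (α := α) hε hεx hL0 (σ₀ := σ₀) (t := γ₀) (δ := δ) hσ₀ hσ₀' hδ'
  have I1 := re_fordK_le (ε₀ := ε₀) (α := α) hε hεx hL0 (σ₀ := σ₀) (t := 0) (δ := δ) hσ₀ hσ₀' hδ'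
  have I3 := re_fordK_le (ε₀ := ε₀) (α := α) hε hεx hL0 (σ₀ := σ₀) (t := γ₀) (δ := δ) hσ₀ hσ₀' hδ'
  simp only at I1 I2 I3 I4
  -- (2) positivity
  have P := sum_re_fordK_nonneg hquad (g := g) (X := x₀ * L) (fun u ↦ testFn_nonneg hε u)
    (fun u hu ↦ testFn_eq_zero hε hL0 hu) σ₀ γ₀
  have hs₁ : ((σ₀ : ℂ) + (0 : ℝ) * I) = (σ₀ : ℂ) := by simp
  rw [hs₁] at I1 I2
  -- (3) the `W`-arguments
  have hW_pole₁ : ((σ₀ : ℂ) - 1) * L - α = ((-lam₀ : ℝ) : ℂ) := by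
    simp only [σ₀, α, lam₀]; push_cast; field_simp; ring
  have hW_pole₂ : ((σ₀ : ℂ) + γ₀ * I - 1) * L - α = ((-lam₀ : ℝ) : ℂ) + (γ₀ * L : ℝ) * I := by
    simp only [σ₀, α, lam₀]; push_cast; field_simp; ring
  have hW_β₁_1 : ((σ₀ : ℂ) - β₁) * L - α = ((lam₁ - lam₀ : ℝ) : ℂ) := by
    simp only [σ₀, α, lam₀, lam₁]; push_cast; field_simp; ring
  have hW_β₁_2 : ((σ₀ : ℂ) + γ₀ * I - β₁) * L - α = ((lam₁ - lam₀ : ℝ) : ℂ) + (γ₀ * L : ℝ) * I := by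
    simp only [σ₀, α, lam₀, lam₁]; push_cast; field_simp; ring
  have hW_ρ₀_2 : ((σ₀ : ℂ) + γ₀ * I - ρ₀) * L - α = 0 := by
    rw [hρ₀eq]; simp only [σ₀, α, lam₀]; rw [← hβ₀]; push_cast; field_simp; ring
  -- real part of `W_ρ` for a general zero: `(β₀ − Re ρ) L`
  have hW_re : ∀ (t : ℝ) (ρ : ℂ), ρ.im = t ∨ True →
      (((σ₀ : ℂ) + t * I - ρ) * L - α).re = (β₀ - ρ.re) * L := by
    intro t ρ _
    simp only [σ₀, α, lam₀, hβ₀]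
    simp only [Complex.sub_re, Complex.mul_re, Complex.add_re, Complex.ofReal_re, Complex.ofReal_im,
      Complex.mul_im, Complex.I_re, Complex.I_im, Complex.add_im, Complex.sub_im]
    field_simp
    ring
  -- (4) signs of the near-zero terms other than `β₁`: `Re H(W_ρ) ≥ 0`
  have hsign : ∀ (t : ℝ), (t = 0 ∨ t = γ₀) → ∀ ρ : ℂ, (riemannZeta ρ = 0 ∨ χ.LFunction ρ = 0) →
      ρ ≠ β₁ → ‖ρ - (1 + t * I)‖ ≤ δ → 0 ≤ (H (((σ₀ : ℂ) + t * I - ρ) * L - α)).re := by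
    intro t ht ρ hz hb hnear
    refine re_shapeLaplace_shape_nonneg hx₀ hε ?_
    rw [hW_re t ρ (Or.inr trivial)]
    -- `Re ρ ≥ 1 - δ`, `|Im ρ - t| ≤ δ`
    have hre : 1 - δ ≤ ρ.re := by
      have := Complex.abs_re_le_norm (ρ - (1 + t * I)); simp at this
      linarith [abs_le.1 (this.trans hnear)]
    have him : |ρ.im - t| ≤ δ := by
      have := Complex.abs_im_le_norm (ρ - (1 + t * I)); simp at this
      exact this.trans hnear
    have him' : |ρ.im| ≤ |ρ₀.im| + δ := by
      rcases ht with rfl | rfl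
      · rw [sub_zero] at him; linarith [abs_nonneg ρ₀.im]
      · have := abs_sub_abs_le_abs_sub ρ.im γ₀; linarith
    have hmx := hmax ρ hz hb hre him'
    have : (β₀ - ρ.re) * L ≥ -ε₀ := by
      have h1 : β₀ - ρ.re ≥ -(ε₀ / L) := by rw [hβ₀]; linarith
      have := mul_le_mul_of_nonneg_right h1 hL0.le
      rw [neg_mul, div_mul_cancel₀ _ hL0.ne'] at this
      linarith
    linarith
  -- (5) non-negativity of `Re H` at real points, and `Re H(0) ≥ 0`
  have hHreal : ∀ σ : ℝ, 0 ≤ (H (σ : ℂ)).re := by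
    intro σ
    simp only [H, h]
    rw [shapeLaplace_ofReal, Complex.ofReal_re]
    exact intervalIntegral.integral_nonneg hx₀ fun u _ ↦ mul_nonneg (shape_nonneg hε u) (Real.exp_nonneg _)
  have hH0 : 0 ≤ (H 0).re := by simpa using hHreal 0
  -- (6) the kept terms
  -- `β₁` as a non-trivial zero
  have hβ₁mem : (β₁ : ℂ) ∈ charNontrivialZeros χ := ⟨hLβ₁, by simp [hβ₁0], by simp [hβ₁1]⟩
  set b₁ : charNontrivialZeros χ := ⟨β₁, hβ₁mem⟩ with hb₁
  have hb₁near : ∀ t : ℝ, ‖(β₁ : ℂ) - (1 + t * I)‖ ≤ δ → b₁ ∈ nearZeros hχ t δ := fun t ht ↦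
    mem_nearZeros.2 (by simpa [hb₁] using ht)
  have hβ₁near0 : ‖(β₁ : ℂ) - (1 + (0 : ℝ) * I)‖ ≤ δ := by
    simp only [Complex.ofReal_zero, zero_mul, add_zero]
    rw [show (β₁ : ℂ) - 1 = ((β₁ - 1 : ℝ) : ℂ) by push_cast; ring, Complex.norm_real, Real.norm_eq_abs,
      abs_of_nonpos (by linarith)]
    linarith
  -- generic: terms of the `χ`-sums with `ρ ≠ β₁` are `≥ 0`
  have hχterm : ∀ (t : ℝ), (t = 0 ∨ t = γ₀) → ∀ ρ ∈ nearZeros hχ t δ, (ρ : ℂ) ≠ β₁ →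
      0 ≤ (m (ρ : ℂ) : ℝ) * (L * (H (((σ₀ : ℂ) + t * I - ρ) * L - α)).re) := by
    intro t ht ρ hρ hne
    have hs := hsign t ht ρ (Or.inr ρ.2.1) hne (mem_nearZeros.1 hρ)
    have hm0 : (0 : ℝ) ≤ m (ρ : ℂ) := Nat.cast_nonneg _
    positivity
  have hζterm : ∀ (t : ℝ), (t = 0 ∨ t = γ₀) → ∀ ρ ∈ nearZerosZeta t δ,
      0 ≤ (riemannZetaZeroOrder (ρ : ℂ) : ℝ) * (L * (H (((σ₀ : ℂ) + t * I - ρ) * L - α)).re) := by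
    intro t ht ρ hρ
    have hne : (ρ : ℂ) ≠ β₁ := fun h' ↦ by
      have := ZetaZeros.riemannZetaNontrivialZeros.im_ne_zero ρ.2
      rw [h'] at this; simp at this
    have hs := hsign t ht ρ (Or.inl (ZetaZeros.riemannZetaNontrivialZeros.zeta_eq_zero ρ.2)) hne
      (mem_nearZerosZeta.1 hρ)
    have hm0 : (0 : ℝ) ≤ riemannZetaZeroOrder (ρ : ℂ) := ZetaZeroSum.zeroOrder_nonneg ρ
    positivity
  -- (K2): `N₂ ≥ L Re H(λ₁ − λ₀)`
  have K2 : L * (H ((lam₁ - lam₀ : ℝ) : ℂ)).re ≤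
      ∑ ρ ∈ nearZeros hχ 0 δ, (m (ρ : ℂ) : ℝ) * (L * (H (((σ₀ : ℂ) - ρ) * L - α)).re) := by
    have hmem := hb₁near 0 hβ₁near0
    have hall : ∀ ρ ∈ nearZeros hχ 0 δ, 0 ≤ (m (ρ : ℂ) : ℝ) * (L * (H (((σ₀ : ℂ) - ρ) * L - α)).re) := by
      intro ρ hρ
      by_cases hne : (ρ : ℂ) = β₁
      · rw [hne, hW_β₁_1]
        have := hHreal (lam₁ - lam₀)
        have hm0 : (0 : ℝ) ≤ m β₁ := Nat.cast_nonneg _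
        positivity
      · have := hχterm 0 (Or.inl rfl) ρ hρ hne
        simpa using this
    have h1 := Finset.single_le_sum hall hmem
    simp only [hb₁] at h1
    rw [hW_β₁_1] at h1
    simp only [m, hm₁, Nat.cast_one, one_mul] at h1
    exact h1
  -- (K1): `N₁ ≥ 0`
  have K1 : 0 ≤ ∑ ρ ∈ nearZerosZeta 0 δ, (riemannZetaZeroOrder (ρ : ℂ) : ℝ) *
      (L * (H (((σ₀ : ℂ) - ρ) * L - α)).re) :=
    Finset.sum_nonneg fun ρ hρ ↦ by simpa using hζterm 0 (Or.inl rfl) ρ hρ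
  -- (K3): `N₃ ≥ [ζ ρ₀ = 0] L Re H(0)`
  have K3 : (if riemannZeta ρ₀ = 0 then L * (H 0).re else 0) ≤
      ∑ ρ ∈ nearZerosZeta γ₀ δ, (riemannZetaZeroOrder (ρ : ℂ) : ℝ) *
        (L * (H (((σ₀ : ℂ) + γ₀ * I - ρ) * L - α)).re) := by
    have hall : ∀ ρ ∈ nearZerosZeta γ₀ δ, 0 ≤ (riemannZetaZeroOrder (ρ : ℂ) : ℝ) *
        (L * (H (((σ₀ : ℂ) + γ₀ * I - ρ) * L - α)).re) := fun ρ hρ ↦ hζterm γ₀ (Or.inr rfl) ρ hρ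
    split_ifs with hζ
    · have hρ₀mem : ρ₀ ∈ RHWave0.riemannZetaNontrivialZeros :=
        ZetaZeros.riemannZetaNontrivialZeros.mem_of_re_pos hζ (by linarith)
      set r₀ : RHWave0.riemannZetaNontrivialZeros := ⟨ρ₀, hρ₀mem⟩ with hr₀
      have hnear : r₀ ∈ nearZerosZeta γ₀ δ := by
        refine mem_nearZerosZeta.2 ?_
        simp only [hr₀]
        rw [hρ₀eq, show (β₀ : ℂ) + γ₀ * I - (1 + γ₀ * I) = ((β₀ - 1 : ℝ) : ℂ) by push_cast; ring,
          Complex.norm_real, Real.norm_eq_abs, abs_of_nonpos (by linarith)]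
        linarith
      have h1 := Finset.single_le_sum hall hnear
      simp only [hr₀] at h1
      rw [hW_ρ₀_2] at h1
      have hm1 : (1 : ℝ) ≤ riemannZetaZeroOrder ρ₀ := by
        exact_mod_cast ZetaZeros.riemannZetaNontrivialZeros.one_le_order hρ₀mem
      calc L * (H 0).re ≤ (riemannZetaZeroOrder ρ₀ : ℝ) * (L * (H 0).re) :=
            le_mul_of_one_le_left (by positivity) hm1
        _ ≤ _ := h1
    · exact Finset.sum_nonneg hall
  -- (K4): `N₄ ≥ [β₁ near] L Re H(W₁') + [L ρ₀ = 0] L Re H(0)`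
  have K4 : (if ‖(β₁ : ℂ) - (1 + γ₀ * I)‖ ≤ δ then L * (H (((lam₁ - lam₀ : ℝ) : ℂ) + (γ₀ * L : ℝ) * I)).re else 0) +
      (if χ.LFunction ρ₀ = 0 then L * (H 0).re else 0) ≤
      ∑ ρ ∈ nearZeros hχ γ₀ δ, (m (ρ : ℂ) : ℝ) * (L * (H (((σ₀ : ℂ) + γ₀ * I - ρ) * L - α)).re) := by
    classical
    set f : ℂ → ℝ := fun z ↦ (m z : ℝ) * (L * (H (((σ₀ : ℂ) + γ₀ * I - z) * L - α)).re) with hf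
    set Tc := (nearZeros hχ γ₀ δ).image Subtype.val with hTc
    have hsum_eq : ∑ ρ ∈ nearZeros hχ γ₀ δ, (m (ρ : ℂ) : ℝ) * (L * (H (((σ₀ : ℂ) + γ₀ * I - ρ) * L - α)).re) =
        ∑ z ∈ Tc, f z := by
      rw [hTc, Finset.sum_image (fun a _ b _ hab ↦ Subtype.ext hab)]
    rw [hsum_eq]
    have hkept := sum_ge_two_kept (Tc := Tc) (f := f) (b₁ := (β₁ : ℂ)) (r := ρ₀) (Ne.symm hρ₀β₁) (by
      intro z hz hne
      obtain ⟨ρ, hρ, rfl⟩ := Finset.mem_image.1 hz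
      exact hχterm γ₀ (Or.inr rfl) ρ hρ hne)
    refine le_trans ?_ hkept
    -- compare the two indicator terms
    have e1 : (if ‖(β₁ : ℂ) - (1 + γ₀ * I)‖ ≤ δ then L * (H (((lam₁ - lam₀ : ℝ) : ℂ) + (γ₀ * L : ℝ) * I)).re else 0) =
        (if (β₁ : ℂ) ∈ Tc then f β₁ else 0) := by
      have hiff : (β₁ : ℂ) ∈ Tc ↔ ‖(β₁ : ℂ) - (1 + γ₀ * I)‖ ≤ δ := by
        rw [hTc, Finset.mem_image]
        constructor
        · rintro ⟨ρ, hρ, hρe⟩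
          have := mem_nearZeros.1 hρ
          rwa [hρe] at this
        · intro hn
          exact ⟨b₁, hb₁near γ₀ hn, rfl⟩
      by_cases hn : ‖(β₁ : ℂ) - (1 + γ₀ * I)‖ ≤ δ
      · rw [if_pos hn, if_pos (hiff.2 hn), hf]
        simp only [m, hm₁, Nat.cast_one, one_mul]
        rw [hW_β₁_2]
      · rw [if_neg hn, if_neg (fun h' ↦ hn (hiff.1 h'))]
    have e2 : (if χ.LFunction ρ₀ = 0 then L * (H 0).re else 0) ≤ (if ρ₀ ∈ Tc then f ρ₀ else 0) := by
      by_cases hLρ : χ.LFunction ρ₀ = 0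
      · have hρ₀mem : ρ₀ ∈ charNontrivialZeros χ := ⟨hLρ, by linarith, hρ₀re1⟩
        have hmemT : ρ₀ ∈ Tc := by
          rw [hTc, Finset.mem_image]
          refine ⟨⟨ρ₀, hρ₀mem⟩, mem_nearZeros.2 ?_, rfl⟩
          show ‖ρ₀ - (1 + γ₀ * I)‖ ≤ δ
          rw [hρ₀eq, show (β₀ : ℂ) + γ₀ * I - (1 + γ₀ * I) = ((β₀ - 1 : ℝ) : ℂ) by push_cast; ring,
            Complex.norm_real, Real.norm_eq_abs, abs_of_nonpos (by linarith)]
          linarith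
        rw [if_pos hLρ, if_pos hmemT, hf]
        simp only
        rw [hW_ρ₀_2]
        have hm1 : (1 : ℝ) ≤ m ρ₀ := by
          simp only [m]; exact_mod_cast one_le_zeroOrder_of_mem hχ hρ₀mem
        exact le_mul_of_one_le_left (by positivity) hm1
      · rw [if_neg hLρ]
        split_ifs with hmemT
        · rw [hf]
          obtain ⟨ρ, hρ, hρe⟩ := Finset.mem_image.1 hmemT
          have := hχterm γ₀ (Or.inr rfl) ρ hρ (by rw [hρe]; exact hρ₀β₁)
          rwa [hρe] at this
        · exact le_rfl
    linarith [e1, e2]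
  -- (7) assembly
  have hg0 : g 0 = h 0 := by simp only [g, h]; rw [testFn_zero, shape_zero]
  -- the indicator bookkeeping: `[ζ ρ₀ = 0] + [L ρ₀ = 0] ≥ 1`
  have hind : L * (H 0).re ≤ (if riemannZeta ρ₀ = 0 then L * (H 0).re else 0) +
      (if χ.LFunction ρ₀ = 0 then L * (H 0).re else 0) := by
    have h0 : 0 ≤ L * (H 0).re := by positivity
    rcases hρ₀ with hz | hz <;> simp only [hz, if_true] <;> split_ifs <;> linarith
  -- the insertion bookkeeping
  have hins : -(if ‖(β₁ : ℂ) - (1 + γ₀ * I)‖ ≤ δ then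
      L * (H (((lam₁ - lam₀ : ℝ) : ℂ) + (γ₀ * L : ℝ) * I)).re else 0) ≤
      -(L * (H (((lam₁ - lam₀ : ℝ) : ℂ) + (γ₀ * L : ℝ) * I)).re) + Ins := by
    simp only [Ins]
    split_ifs with hn
    · linarith
    · have h1 := Complex.abs_re_le_norm (H (((lam₁ - lam₀ : ℝ) : ℂ) + (γ₀ * L : ℝ) * I))
      have h2 := (le_abs_self _).trans h1
      have h3 := mul_le_mul_of_nonneg_left h2 hL0.le
      linarith
  rw [hW_pole₁] at I1
  rw [hW_pole₂] at I3
  simp only [abs_zero] at I1 I2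
  -- everything in place
  have h0nn : 0 ≤ h 0 := shape_nonneg hε 0
  simp only [Eχ, Eζ, Farχ, Farζ, Tr, abs_zero, s₁, s₂, Complex.ofReal_zero, zero_mul, add_zero]
  linarith [P, I1, I2, I3, I4, K1, K2, K3, K4, hind, hins, h0nn]

end DHTest

end Literature.NumberTheory.LFunctions

end
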